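import Summits.QuantumFields.YangMills.Theorems.SwapVirialDeficitSectorLaplaceEndShellLetters
import Summits.QuantumFields.YangMills.Theorems.SwapVirialDeficitSectorLaplaceMbDensityBulkIntegrable
import HarnessLib

/-!
# Route `SwapVirialDeficit` (YangMills): THE SHELL SIDE OF T-N6b DISCHARGED — box masses along the shell letters are integrable and below the bulk main term
# (cell ym-idea-1, skeleton ➎, `stub_core_tip`: the hypotheses `hInt`, `hS` and the right side of w3 g68's ✓∕⧗`tipMid_le_shell_of_pointwise`, in the letters of
# ✓`mbMain_ge_of_subset`; free-hands support of ⟨stmt-QuantumFields-24197⟩ `SwapVirialDeficit.SwapGluedStiffness`)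

For good signs `ε`, a cut `0 < τ ≤ 1` and a shell letter `δ` in the bulk window `{τ ≤ 4δ²/(1+δ²)² ∧ τ ≤ (1+δ²)⁻¹}`:
* §1 `integrable_mbDensity_hubAt_of_window` — `p ↦ 𝔪(hubAt δ 1, ε, p)` is integrable on `ℝ²` (majorant `C·(1+x₀²)⁻¹(1+y₀²)⁻¹` of ✓`exists_mbDensity_le_weight_of_hubBulk`), hence on any box;
  `Icc_subset_bulkWindow` — `Icc δ_r c ⊆ window` for `1 ≤ δ_r` and `c² ≤ τ⁻¹ − 1` (the adjacent shell `[cot r, δ_τ]`, `δ_τ = √(τ⁻¹ − 1)`);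
* §2 `measurable_boxMass_hubAt`, ★ `integrableOn_sqInv_mul_boxMass` — `δ ↦ ((1+δ²)⁻¹)²·∫_{Box}𝔪(hubAt δ 1, ε, ·)` is integrable on the window (dominated by the full plane mass,
  ✓`integrableOn_planeMass_hubCot`);
* §3 ★★ `shell_boxMass_le_mbMain` — `coneConst·π·∫_{Icc δ_r c} ((1+δ²)⁻¹)²·∫_{Box}𝔪(hubAt δ 1, ε, ·) ≤ ∫_{HubBulk τ}∫_{ℝ²}𝔪_ε dcone` (drop the box, ✓`mbMain_ge_of_subset`), which LEAD's
  ✓`bulkHub_ge_half_main` turns into `≤ 2(2π/b)^{−α}·∫_{HubBulk τ} hubIntegral` above the bulk threshold.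

HONEST LABEL: bookkeeping; the pointwise sandwich (w2 g61), tip-core, corner, ends and the assembly of `hT` remain; `stub_core_tip`, ⟨24197⟩ ∕ ⟨24194⟩ OPEN; own crux ⟨22884⟩
`LargeFieldMassRefinementTail` OPEN (blocked-on ⟨19935⟩); the Yang–Mills mass gap is NOT proved; no summit is proved by a line.  THEOREMS ONLY (0 `def`, 0 `sorry`, no instance),
standard axioms.  Width seat ym-line-sfw-p2-w3 g68 (cell ym-idea-1, free hands), `--supports stmt-QuantumFields-24197`.  References: [folklore].
-/

set_option autoImplicit false
set_option synthInstance.maxSize 1024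

noncomputable section

open MeasureTheory Quaternion Set Filter
open scoped Quaternion BigOperators ENNReal
open Literature.MathematicalPhysics.QuantumLattice
open Literature.MathematicalPhysics.QuantumFieldTheory hiding SU2
open Summit.QuantumFields.YangMills.Theorems.SwapTwistDeficit.ToronLog

namespace Summit.QuantumFields.YangMills.Theorems.SwapVirialDeficit.SectorLaplace

open Summit.QuantumFields.YangMills.Theorems.FemtoTransferGap
open Summit.QuantumFields.YangMills.Theorems.FemtoTransferGap.TT
open Summit.QuantumFields.YangMills.Theorems.VirialFluxGap.RingDeficit
open Summit.QuantumFields.YangMills.Theorems.SwapVirialDeficit.SwapRing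
open Summit.QuantumFields.YangMills.Theorems.SwapVirialDeficit.BlowUpRing

variable {L : ℕ} [NeZero L]

/-! ## §1 Plane integrability along the shell and the shell window -/

/-- ★ For good `ε`, `0 < τ ≤ 1` and `δ` in the bulk window, `p ↦ 𝔪(hubAt δ 1, ε, p)` is integrable on `ℝ²` (✓`exists_mbDensity_le_weight_of_hubBulk`). [folklore] -/
theorem integrable_mbDensity_hubAt_of_window {ε : GnoSign L} (hε : GoodSign ε) {τ : ℝ} (hτ : 0 < τ) (hτ1 : τ ≤ 1) {δ : ℝ}
    (hδ : τ ≤ 4 * δ ^ 2 / (1 + δ ^ 2) ^ 2 ∧ τ ≤ (1 + δ ^ 2)⁻¹) :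
    Integrable fun p : ℝ × ℝ => mbDensity (L := L) (hubAt δ 1) ε p := by
  obtain ⟨C, hC0, hC⟩ := exists_mbDensity_le_weight_of_hubBulk (L := L) hε hτ hτ1
  obtain ⟨hw0pos, hw0m, hw0i⟩ := rescaledWeight_facts
  have hcot := mem_hubBulk_iff_cot (hubAt_one_im_ne_zero δ) τ
  have hre : (hubAt δ 1).re / ‖(hubAt δ 1).im‖ = δ := by
    rw [norm_im_hubAt_one, div_one]; rfl
  rw [hre] at hcot
  have hmem : hubAt δ 1 ∈ HubBulk τ := hcot.2 hδ
  have hm : Measurable fun p : ℝ × ℝ => mbDensity (L := L) (hubAt δ 1) ε p := measurable_mbDensity_base (hubAt_one_ne_zero δ) ε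
  have hmaj : Integrable (fun p : ℝ × ℝ => C * ((1 + p.1 ^ 2)⁻¹ * (1 + p.2 ^ 2)⁻¹)) := hw0i.const_mul C
  refine hmaj.mono' hm.aestronglyMeasurable (Eventually.of_forall fun p => ?_)
  have h0 : 0 ≤ mbDensity (L := L) (hubAt δ 1) ε p := mbDensity_nonneg _ ε p
  rw [Real.norm_eq_abs, abs_of_nonneg h0]
  exact hC (hubAt δ 1) hmem p

omit [NeZero L] in
/-- The adjacent shell in the letter `δ` lies in the bulk window: `Icc δ_r c ⊆ {τ ≤ 4δ²/(1+δ²)² ∧ τ ≤ (1+δ²)⁻¹}` for `0 < τ`, `1 ≤ δ_r`, `c² ≤ τ⁻¹ − 1`. [folklore] -/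
theorem Icc_subset_bulkWindow {τ δr c : ℝ} (hτ : 0 < τ) (hδr : 1 ≤ δr) (hc : c ^ 2 ≤ τ⁻¹ - 1) :
    Icc δr c ⊆ {δ : ℝ | τ ≤ 4 * δ ^ 2 / (1 + δ ^ 2) ^ 2 ∧ τ ≤ (1 + δ ^ 2)⁻¹} := by
  intro δ hδ
  have hδ1 : 1 ≤ δ := hδr.trans hδ.1
  have hδ2 : δ ^ 2 ≤ τ⁻¹ - 1 := by
    have h0 : 0 ≤ δ := by linarith
    exact (pow_le_pow_left₀ h0 hδ.2 2).trans hc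
  have hpos : 0 < 1 + δ ^ 2 := by positivity
  have h2 : τ ≤ (1 + δ ^ 2)⁻¹ := by
    rw [le_inv_comm₀ hτ hpos]
    linarith
  refine ⟨h2.trans ?_, h2⟩
  -- `(1+δ²)⁻¹ ≤ 4δ²/(1+δ²)²` for `δ² ≥ 1/3`
  rw [inv_eq_one_div, div_le_div_iff₀ hpos (by positivity)]
  nlinarith

/-! ## §2 The box mass along the shell letters -/

/-- `δ ↦ ∫_{Box}𝔪(hubAt δ 1, ε, p) dp` is measurable (✓`measurable_mbDensity_hubAt`, `StronglyMeasurable.integral_prod_right'` on `vol|_{Box}`). [folklore] -/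
theorem measurable_boxMass_hubAt (ε : GnoSign L) (Box : Set (ℝ × ℝ)) :
    Measurable fun δ : ℝ => ∫ p in Box, mbDensity (L := L) (hubAt δ 1) ε p := by
  have h := (measurable_mbDensity_hubAt (L := L) ε).stronglyMeasurable.integral_prod_right' (ν := (volume : Measure (ℝ × ℝ)).restrict Box)
  exact h.measurable

/-- `0 ≤ ∫_{Box}𝔪(hubAt δ 1) ≤ ∫_{ℝ²}𝔪(hubAt δ 1)` for `δ` in the bulk window. [folklore] -/
theorem boxMass_hubAt_le_planeMass {ε : GnoSign L} (hε : GoodSign ε) {τ : ℝ} (hτ : 0 < τ) (hτ1 : τ ≤ 1) {δ : ℝ}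
    (hδ : τ ≤ 4 * δ ^ 2 / (1 + δ ^ 2) ^ 2 ∧ τ ≤ (1 + δ ^ 2)⁻¹) (Box : Set (ℝ × ℝ)) :
    0 ≤ ∫ p in Box, mbDensity (L := L) (hubAt δ 1) ε p ∧ ∫ p in Box, mbDensity (L := L) (hubAt δ 1) ε p ≤ ∫ p : ℝ × ℝ, mbDensity (L := L) (hubAt δ 1) ε p :=
  ⟨integral_nonneg fun p => mbDensity_nonneg _ ε p,
    setIntegral_le_integral (integrable_mbDensity_hubAt_of_window hε hτ hτ1 hδ) (Eventually.of_forall fun p => mbDensity_nonneg _ ε p)⟩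

/-- ★ **THE BOX MASS ALONG THE SHELL IS INTEGRABLE**: for good `ε`, `0 < τ ≤ 1` and any `Box`, `δ ↦ ((1+δ²)⁻¹)²·∫_{Box}𝔪(hubAt δ 1, ε, ·)` is integrable on the bulk window
(dominated by the plane mass, ✓`integrableOn_planeMass_hubCot`) — the hypothesis `hS` of ✓`tipMid_le_shell_of_pointwise` on any shell inside the window. [folklore] -/
theorem integrableOn_sqInv_mul_boxMass {ε : GnoSign L} (hε : GoodSign ε) {τ : ℝ} (hτ : 0 < τ) (hτ1 : τ ≤ 1) (Box : Set (ℝ × ℝ)) :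
    IntegrableOn (fun δ : ℝ => ((1 + δ ^ 2)⁻¹) ^ 2 * ∫ p in Box, mbDensity (L := L) (hubAt δ 1) ε p)
      {δ : ℝ | τ ≤ 4 * δ ^ 2 / (1 + δ ^ 2) ^ 2 ∧ τ ≤ (1 + δ ^ 2)⁻¹} := by
  have hW := measurableSet_bulkWindow τ
  have hm : Measurable fun δ : ℝ => ((1 + δ ^ 2)⁻¹) ^ 2 * ∫ p in Box, mbDensity (L := L) (hubAt δ 1) ε p :=
    (((measurable_const.add (measurable_id.pow_const 2)).inv).pow_const 2).mul (measurable_boxMass_hubAt ε Box)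
  refine Integrable.mono' (integrableOn_planeMass_hubCot (L := L) hε hτ hτ1) hm.aestronglyMeasurable ?_
  filter_upwards [ae_restrict_mem hW] with δ hδ
  obtain ⟨h0, hle⟩ := boxMass_hubAt_le_planeMass (L := L) hε hτ hτ1 hδ Box
  rw [Real.norm_eq_abs, abs_of_nonneg (mul_nonneg (by positivity) h0)]
  exact mul_le_mul_of_nonneg_left hle (by positivity)

/-! ## §3 The shell box mass is below the bulk main term -/

/-- ★★ **THE SHELL SIDE OF T-N6b, DISCHARGED**: for good `ε`, `0 < τ ≤ 1`, `1 ≤ δ_r`, `c² ≤ τ⁻¹ − 1` and any `Box`,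
`coneConst·π·∫_{Icc δ_r c} ((1+δ²)⁻¹)²·∫_{Box}𝔪(hubAt δ 1, ε, ·) dδ ≤ ∫_{HubBulk τ}∫_{ℝ²}𝔪_ε dcone` (drop the box; ✓`mbMain_ge_of_subset` on `Icc δ_r c ⊆ window`). [folklore] -/
theorem shell_boxMass_le_mbMain {ε : GnoSign L} (hε : GoodSign ε) {τ : ℝ} (hτ : 0 < τ) (hτ1 : τ ≤ 1) {δr c : ℝ} (hδr : 1 ≤ δr) (hc : c ^ 2 ≤ τ⁻¹ - 1)
    (Box : Set (ℝ × ℝ)) :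
    coneConst * Real.pi * ∫ δ in Icc δr c, ((1 + δ ^ 2)⁻¹) ^ 2 * ∫ p in Box, mbDensity (L := L) (hubAt δ 1) ε p ≤
      ∫ a in HubBulk τ, (∫ p : ℝ × ℝ, mbDensity (L := L) a ε p) ∂coneMeasure := by
  have hsub := Icc_subset_bulkWindow hτ hδr hc
  refine le_trans (mul_le_mul_of_nonneg_left ?_ (mul_pos coneConst_pos Real.pi_pos).le) (mbMain_ge_of_subset (L := L) hε hτ hτ1 hsub)
  refine setIntegral_mono_on ((integrableOn_sqInv_mul_boxMass hε hτ hτ1 Box).mono_set hsub) ((integrableOn_planeMass_hubCot hε hτ hτ1).mono_set hsub)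
    measurableSet_Icc fun δ hδ => ?_
  exact mul_le_mul_of_nonneg_left (boxMass_hubAt_le_planeMass (L := L) hε hτ hτ1 (hsub hδ) Box).2 (by positivity)

end Summit.QuantumFields.YangMills.Theorems.SwapVirialDeficit.SectorLaplace

end
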